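import Summits.Ventures.PercRepro.S2TwelveSevenK1Nu
import Summits.Ventures.PercRepro.S2ThirteenSevenNuFour

/-!
# PercRepro — S2: THE CASE `ν = 4` OF THE SCALED COLOOP-FREE CELL `(12, 7)` AT `K₁ = 10219`, AND THE SCALED CELL ITSELF
(p7, gen 17; sub-claim S2; the first coloop step of the cell `(13, 7)`)

S2ThirteenSevenNuFour at `19` points: the contraction lever with the two counts of S2NuFourTools — at `w = 9`, `#U ≤ 27615`
against `32014` (`m = 222`, ratio `0.86`); at `w = 8`, `#U ≤ 22954` against `32892` (`0.70`); the tail by flats at `(9, 8)` =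
`10870391/180`. **`c025_twelve_seven_cfk1_nu_four`**, and with `S2TwelveSevenK1Nu`:
**`c025_twelve_seven_cfk1 (M) [M.Finite] (hR : eRank = 12) (hn : |E| = 12 + 7) (hfree) (hK) : (Φ(13, 5) − 2)/2 · #U(12, 5) ≤ mid(12, 5)`**
— THE SCALED COLOOP-FREE CELL `(12, 7)` OF `(13, 7)` AT `K₁`, UNCONDITIONAL (the hypothesis `hk1` of `c025_core_five_thirteen_seven_of_cells`).
Nothing about the cell `(13, 7)` or the window is claimed. Axioms: standard.
-/

open scoped Matroid

namespace PercRepro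

namespace ThmN

open Set

variable {α : Type}

/-- **The case `ν = 4` of the scaled coloop-free cell `(12, 7)` at `K₁`** (see the module docstring). -/
theorem c025_twelve_seven_cfk1_nu_four (M : Matroid α) [M.Finite]
    (hR : M.eRank = ((12 : ℕ) : ℕ∞)) (hn : M.E.ncard = 12 + 7)
    (hfree : ∀ e ∈ M.E, ∃ A ⊆ M.E \ {e}, e ∉ M.closure A ∧ e ∉ M.closure ((M.E \ {e}) \ A)) (hK : ∀ e, ¬ M.IsColoop e)
    (h5 : ¬ ∃ W ⊆ M.E, W.ncard ≤ 10 ∧ W.encard = M.eRk W + 5)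
    (h4 : ∃ W ⊆ M.E, W.ncard ≤ 9 ∧ W.encard = M.eRk W + 4) :
    ((phiK 13 5 - 2) / 2) * (Matroid.topCount M 12 5 : ℚ) ≤ (Matroid.midCount M 12 5 : ℚ) := by
  classical
  have hd : M.E.encard = M.eRank + ((7 : ℕ) : ℕ∞) := by
    rw [hR, ← M.ground_finite.cast_ncard_eq, hn]
    push_cast
    ring
  obtain ⟨hs3, hs4, hs5⟩ := caps_twelve_seven_cf M hd hn hfree hK
  have hL0 : ∀ e ∈ M.E, ¬ M.IsLoop e := not_isLoop_of_free M hfree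
  have hs : ∀ e ∈ M.E, ∀ f ∈ M.E, e ≠ f → M.eRk {e, f} = 2 := by
    intro e he f hf hef
    have h2 : (2 : ℕ∞) ≤ M.eRk {e, f} :=
      two_le_eRk_of_two_le_ncard_of_free M hfree (pair_subset he hf) (by rw [ncard_pair hef])
    have h3 : M.eRk {e, f} ≤ 2 := by
      have := M.eRk_le_encard {e, f}
      rwa [encard_pair hef] at this
    exact le_antisymm h3 h2
  have hC1 : ∀ L ⊆ M.E, M.eRk L = 2 → L.ncard ≤ 3 :=
    fun L hL hr => ncard_le_three_of_eRk_two M hs hfree hL hr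
  have hflat : ∀ X ⊆ M.E, M.eRk X ≤ 5 → X.ncard ≤ 9 := fun X hX hr => by
    have := S2.ncard_le_of_eRk_le_of_not_nullity M 5 10 (by norm_num) h5 hX (r := 5) (by norm_num) (by exact_mod_cast hr)
    omega
  have hflat' : ∀ X ⊆ M.E, M.eRk X ≤ 4 → X.ncard ≤ 8 := fun X hX hr => by
    have := S2.ncard_le_of_eRk_le_of_not_nullity M 5 10 (by norm_num) h5 hX (r := 4) (by norm_num) (by exact_mod_cast hr)
    omega
  -- the set `W`
  obtain ⟨W, hW, hWn, hWk⟩ := h4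
  have hWfin : W.Finite := M.ground_finite.subset hW
  have hWne : M.eRk W ≠ ⊤ := ((M.eRk_le_encard W).trans_lt hWfin.encard_lt_top).ne
  obtain ⟨r, hr⟩ := ENat.ne_top_iff_exists.1 hWne
  have hWr : W.ncard = r + 4 := by
    have h := hWk
    rw [← hr, ← hWfin.cast_ncard_eq] at h
    exact_mod_cast h
  have hr4 : 4 ≤ r := by
    by_contra hlt
    push Not at hlt
    have h3 : M.eRk W ≤ 3 := by rw [← hr]; exact_mod_cast (by omega : r ≤ 3)
    have h6 := ncard_le_six_of_eRk_le_three_of_free M hfree hW h3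
    have h2 : M.eRk W ≤ 2 := by rw [← hr]; exact_mod_cast (by omega : r ≤ 2)
    have h3' := S2.ncard_le_three_of_eRk_le_two M hs hC1 hW h2
    omega
  have hr5 : r ≤ 5 := by omega
  -- `W` is a flat
  have hWcl : M.closure W = W := by
    refine le_antisymm ?_ (M.subset_closure W hW)
    intro x hx
    by_contra hxW
    have hxE : x ∈ M.E := M.closure_subset_ground W hx
    apply h5
    refine ⟨insert x W, Set.insert_subset hxE hW, ?_, ?_⟩
    · rw [Set.ncard_insert_of_notMem hxW hWfin]; omega
    · rw [Set.encard_insert_of_notMem hxW, ← M.eRk_closure_eq, M.closure_insert_eq_of_mem_closure hx,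
        M.eRk_closure_eq, hWk]
      ring
  -- the contraction `M ／ W`
  have hNE : (M ／ W).E = M.E \ W := Matroid.contract_ground M W
  have hRW : (M.E \ W).ncard = 19 - (r + 4) := by
    rw [Set.ncard_sdiff hW hWfin, hn, hWr]
  have hNEcard : (M ／ W).E.ncard = 19 - (r + 4) := by rw [hNE, hRW]
  have hNL : ∀ e ∈ (M ／ W).E, ¬ (M ／ W).IsLoop e := S2.contract_not_isLoop_of_closure_eq M hWcl
  have hν : (M ／ W)✶.eRank = ((3 : ℕ) : ℕ∞) := by
    have h := S2.eRank_dual_contract_add M hW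
    rw [hR, ← hr, ← M.ground_finite.sdiff.cast_ncard_eq, hRW] at h
    have h2 : ((r : ℕ) : ℕ∞) + ((19 - (r + 4) : ℕ) : ℕ∞) = ((3 : ℕ) : ℕ∞) + ((12 : ℕ) : ℕ∞) := by
      norm_cast
      omega
    rw [h2] at h
    exact WithTop.add_right_cancel (WithTop.natCast_ne_top 12) h
  -- the counts on `N`
  have hD2N := S2.ncard_dep_two_le (M ／ W) hν hNL
  have hD3N := S2.ncard_dep_three_le (M ／ W) hν hNL
  have hT3N := S2.ncard_allpairs_dep_three_mul_three_le (M ／ W)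
  rw [hNEcard] at hD3N hT3N
  norm_num [Nat.choose] at hD2N hD3N
  have hT3four := S2.ncard_allpairs_dep_three_le_four (M ／ W) hNL hD2N
  have hD1N : {X : Set α | X ⊆ (M ／ W).E ∧ X.ncard = 1 ∧ (M ／ W).Dep X}.ncard = 0 := by
    rw [Set.ncard_eq_zero ((M ／ W).ground_finite.finite_subsets.subset (fun X hX => hX.1)), Set.eq_empty_iff_forall_notMem]
    rintro X ⟨hXE, hX1, hXdep⟩
    obtain ⟨e, rfl⟩ := Set.ncard_eq_one.1 hX1
    exact hNL e (hXE (Set.mem_singleton e)) (Matroid.singleton_dep.1 hXdep)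
  have hD0N : {X : Set α | X ⊆ (M ／ W).E ∧ X.ncard = 0 ∧ (M ／ W).Dep X}.ncard = 0 := by
    rw [Set.ncard_eq_zero ((M ／ W).ground_finite.finite_subsets.subset (fun X hX => hX.1)), Set.eq_empty_iff_forall_notMem]
    rintro X ⟨hXE, hX0, hXdep⟩
    rw [Set.ncard_eq_zero ((M ／ W).ground_finite.subset hXE)] at hX0
    subst hX0
    exact hXdep.not_indep (M ／ W).empty_indep
  -- the counts on `W`
  have hD3W := S2.ncard_dep_three_mul_three_le M hs hC1 hW
  have hR42 := S2.ncard_four_eRk_le_two_eq_zero M hs hC1 hW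
  rw [hWr] at hD3W
  -- the two new counts: `Dep₄(W) ≤ I₃(W)` and the all-pairs-dependent triples of `N` number `≤ 4`
  have hDep4 := S2.ncard_dep_four_le_ncard_indep_three M hfree hs hC1 hW
  have hR43le : {T : Set α | T ⊆ W ∧ T.ncard = 4 ∧ M.eRk T = 3}.ncard ≤ {T : Set α | T ⊆ W ∧ T.ncard = 4 ∧ M.Dep T}.ncard := by
    refine Set.ncard_le_ncard ?_ (hWfin.finite_subsets.subset (fun T hT => hT.1))
    rintro T ⟨hTW, hT4, hTr⟩
    refine ⟨hTW, hT4, ?_⟩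
    rw [← Matroid.eRk_lt_encard_iff_dep_of_finite (hWfin.subset hTW) (hTW.trans hW), hTr,
      ← (hWfin.subset hTW).cast_ncard_eq, hT4]
    norm_num
  -- the splits `I_j + Dep_j ≤ C(w, j)`
  have hsplit : ∀ j, {T : Set α | T ⊆ W ∧ T.ncard = j ∧ M.Indep T}.ncard + {T : Set α | T ⊆ W ∧ T.ncard = j ∧ M.Dep T}.ncard ≤ W.ncard.choose j := by
    intro j
    rw [← S2.ncard_subsets_ncard_eq W hWfin j, ← Set.ncard_union_eq (Set.disjoint_left.2 (fun T h1 h2 => h2.2.2.not_indep h1.2.2))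
      (hWfin.finite_subsets.subset (fun T hT => hT.1)) (hWfin.finite_subsets.subset (fun T hT => hT.1))]
    exact Set.ncard_le_ncard (Set.union_subset (fun T hT => ⟨hT.1, hT.2.1⟩) (fun T hT => ⟨hT.1, hT.2.1⟩)) (hWfin.finite_subsets.subset (fun T hT => hT.1))
  have hsplit4 : {T : Set α | T ⊆ W ∧ T.ncard = 4 ∧ M.Indep T}.ncard + {T : Set α | T ⊆ W ∧ T.ncard = 4 ∧ M.eRk T = 3}.ncard ≤ W.ncard.choose 4 := by
    rw [← S2.ncard_subsets_ncard_eq W hWfin 4, ← Set.ncard_union_eq (Set.disjoint_left.2 (fun T h1 h2 => by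
        have h := h1.2.2.eRk_eq_encard
        rw [h2.2.2, ← (hWfin.subset h1.1).cast_ncard_eq, h1.2.1] at h
        norm_num at h))
      (hWfin.finite_subsets.subset (fun T hT => hT.1)) (hWfin.finite_subsets.subset (fun T hT => hT.1))]
    exact Set.ncard_le_ncard (Set.union_subset (fun T hT => ⟨hT.1, hT.2.1⟩) (fun T hT => ⟨hT.1, hT.2.1⟩)) (hWfin.finite_subsets.subset (fun T hT => hT.1))
  have hsplit5 : {T : Set α | T ⊆ W ∧ T.ncard = 5 ∧ 4 ≤ M.eRk T}.ncard + {T : Set α | T ⊆ W ∧ T.ncard = 5 ∧ M.eRk T ≤ 3}.ncard ≤ W.ncard.choose 5 := by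
    rw [← S2.ncard_subsets_ncard_eq W hWfin 5, ← Set.ncard_union_eq (Set.disjoint_left.2 (fun T h1 h2 => by
        have := h1.2.2.trans h2.2.2
        norm_num at this))
      (hWfin.finite_subsets.subset (fun T hT => hT.1)) (hWfin.finite_subsets.subset (fun T hT => hT.1))]
    exact Set.ncard_le_ncard (Set.union_subset (fun T hT => ⟨hT.1, hT.2.1⟩) (fun T hT => ⟨hT.1, hT.2.1⟩)) (hWfin.finite_subsets.subset (fun T hT => hT.1))
  have hsub6 : {T : Set α | T ⊆ W ∧ T.ncard = 6 ∧ M.Dep T}.ncard ≤ W.ncard.choose 6 := by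
    rw [← S2.ncard_subsets_ncard_eq W hWfin 6]
    exact Set.ncard_le_ncard (fun T hT => ⟨hT.1, hT.2.1⟩) (hWfin.finite_subsets.subset (fun T hT => hT.1))
  have hsub5d : {T : Set α | T ⊆ W ∧ T.ncard = 5 ∧ M.Dep T}.ncard ≤ W.ncard.choose 5 := by
    rw [← S2.ncard_subsets_ncard_eq W hWfin 5]
    exact Set.ncard_le_ncard (fun T hT => ⟨hT.1, hT.2.1⟩) (hWfin.finite_subsets.subset (fun T hT => hT.1))
  have hsubT3 : {X : Set α | X ⊆ (M ／ W).E ∧ X.ncard = 3 ∧ ∀ x ∈ X, ∀ y ∈ X, x ≠ y → (M ／ W).Dep {x, y}}.ncard ≤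
      {X : Set α | X ⊆ (M ／ W).E ∧ X.ncard = 3 ∧ (M ／ W).Dep X}.ncard := by
    refine Set.ncard_le_ncard ?_ ((M ／ W).ground_finite.finite_subsets.subset (fun X hX => hX.1))
    rintro X ⟨hXE, hX3, hpairs⟩
    refine ⟨hXE, hX3, ?_⟩
    obtain ⟨a, b, c, hab, -, -, rfl⟩ := Set.ncard_eq_three.1 hX3
    exact (hpairs a (Set.mem_insert a _) b (Set.mem_insert_of_mem a (Set.mem_insert b _)) hab).superset
      (Set.pair_subset (Set.mem_insert a _) (Set.mem_insert_of_mem a (Set.mem_insert b _))) hXE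
  -- the hitting bounds
  have hhit : ∀ B, B ⊆ M.E → M.eRk (M.E \ B) = M.eRank → B.ncard + 4 ≤ 7 + (B ∩ W).ncard := by
    intro B hBE hBs
    have h := S2.encard_add_le_of_spanning_compl_of_nullity M hBE hW hBs hd hWk hWne (by rw [hR]; exact WithTop.natCast_ne_top 12)
    rw [Set.inter_comm, ← (M.ground_finite.subset hBE).cast_ncard_eq, ← ((M.ground_finite.subset hBE).inter_of_left W).cast_ncard_eq] at h
    exact_mod_cast h
  have hhit6 : ∀ B, B ⊆ M.E → B.ncard = 6 → M.eRk B = 5 → M.eRk (M.E \ B) = M.eRank → 3 ≤ (B ∩ W).ncard := by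
    intro B hBE hB6 _ hBs
    have := hhit B hBE hBs
    omega
  have hhit7 : ∀ B, B ⊆ M.E → B.ncard = 7 → M.eRk B = 5 → M.eRk (M.E \ B) = M.eRank → 4 ≤ (B ∩ W).ncard := by
    intro B hBE hB7 _ hBs
    have := hhit B hBE hBs
    omega
  -- the top count: `5`-, `6`- and `7`-sets
  have hU1 := S2.topCount_le_ncard_compl_spanning (M := M) hR hd 5
  simp only [Nat.cast_ofNat] at hU1
  have hsplitU : {B : Set α | B ⊆ M.E ∧ M.eRk B = 5 ∧ B.ncard ≤ 7 ∧ M.eRk (M.E \ B) = M.eRank}.ncard ≤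
      {B : Set α | B ⊆ M.E ∧ B.ncard = 5 ∧ M.eRk (M.E \ B) = M.eRank}.ncard +
      {B : Set α | B ⊆ M.E ∧ B.ncard = 6 ∧ M.eRk B = 5 ∧ M.eRk (M.E \ B) = M.eRank}.ncard +
      {B : Set α | B ⊆ M.E ∧ B.ncard = 7 ∧ M.eRk B = 5 ∧ M.eRk (M.E \ B) = M.eRank}.ncard := by
    have hF1 : {B : Set α | B ⊆ M.E ∧ B.ncard = 5 ∧ M.eRk (M.E \ B) = M.eRank}.Finite :=
      M.ground_finite.finite_subsets.subset (fun B hB => hB.1)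
    have hF2 : {B : Set α | B ⊆ M.E ∧ B.ncard = 6 ∧ M.eRk B = 5 ∧ M.eRk (M.E \ B) = M.eRank}.Finite :=
      M.ground_finite.finite_subsets.subset (fun B hB => hB.1)
    have hF3 : {B : Set α | B ⊆ M.E ∧ B.ncard = 7 ∧ M.eRk B = 5 ∧ M.eRk (M.E \ B) = M.eRank}.Finite :=
      M.ground_finite.finite_subsets.subset (fun B hB => hB.1)
    refine le_trans (Set.ncard_le_ncard ?_ ((hF1.union hF2).union hF3)) ?_
    · rintro B ⟨hBE, hB5, hB7, hBs⟩
      have hBfin : B.Finite := M.ground_finite.subset hBE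
      have h5le : 5 ≤ B.ncard := by
        have := M.eRk_le_encard B
        rw [hB5, ← hBfin.cast_ncard_eq] at this
        exact_mod_cast this
      rcases (show B.ncard = 5 ∨ B.ncard = 6 ∨ B.ncard = 7 by omega) with h | h | h
      · exact Or.inl (Or.inl ⟨hBE, h, hBs⟩)
      · exact Or.inl (Or.inr ⟨hBE, h, hB5, hBs⟩)
      · exact Or.inr ⟨hBE, h, hB5, hBs⟩
    · have h1 := Set.ncard_union_le ({B : Set α | B ⊆ M.E ∧ B.ncard = 5 ∧ M.eRk (M.E \ B) = M.eRank} ∪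
        {B : Set α | B ⊆ M.E ∧ B.ncard = 6 ∧ M.eRk B = 5 ∧ M.eRk (M.E \ B) = M.eRank})
        {B : Set α | B ⊆ M.E ∧ B.ncard = 7 ∧ M.eRk B = 5 ∧ M.eRk (M.E \ B) = M.eRank}
      have h2 := Set.ncard_union_le {B : Set α | B ⊆ M.E ∧ B.ncard = 5 ∧ M.eRk (M.E \ B) = M.eRank}
        {B : Set α | B ⊆ M.E ∧ B.ncard = 6 ∧ M.eRk B = 5 ∧ M.eRk (M.E \ B) = M.eRank}
      omega
  have htop5 := S2.ncard_spanning_compl_le_of_nullity M hW hd hWk (m := 5)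
  have htop6 := S2.ncard_top_le_sum_contract M hW 6 3 (by norm_num) hhit6
  have htop7 := S2.ncard_top_seven_le_contract M hW hhit7
  rw [Finset.sum_Icc_succ_top (by norm_num : 3 ≤ 6), Finset.sum_Icc_succ_top (by norm_num : 3 ≤ 5),
    Finset.sum_Icc_succ_top (by norm_num : 3 ≤ 4), Finset.Icc_self, Finset.sum_singleton] at htop6
  simp only [show (6 : ℕ) - 3 = 3 from rfl, show (6 : ℕ) - 4 = 2 from rfl, show (6 : ℕ) - 5 = 1 from rfl,
    show (6 : ℕ) - 6 = 0 from rfl] at htop6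
  rw [hNE] at hT3N hD1N hD0N hsubT3 hT3four
  rw [hD1N, hD0N, hRW] at htop6
  rw [hRW] at htop7
  -- the tail
  have hA := ncard_eRk_le_five_le_flats M 12 7 (by norm_num) hR hn hfree 9 8 hflat hflat' (by norm_num) (by norm_num) (by norm_num) (by norm_num)
    11 58 317 hs3 hs4 hs5
  have hA' : ({X : Set α | X ⊆ M.E ∧ M.eRk X ≤ 5}.ncard : ℚ) ≤ 10870391 / 180 := by
    norm_num [Finset.sum_range_succ, Nat.choose] at hA
    linarith
  have hS := S2.ncard_spanning_le_of_nullity M hW hd hWk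
  rw [hn] at hS htop5
  have cellA : ∀ (U S m : ℕ) (A : ℚ), Matroid.topCount M 12 5 ≤ U → ({X : Set α | X ⊆ M.E ∧ M.eRk X ≤ 5}.ncard : ℚ) ≤ A →
      {X : Set α | X ⊆ M.E ∧ M.eRk X = M.eRank}.ncard ≤ S → m ≤ 1024 →
      1024 * (U : ℚ) ≤ ((1024 - m : ℕ) : ℚ) * 2 ^ (7 - 5) * (10219 : ℚ) →
      (1024 : ℚ) * (A + (S : ℚ)) ≤ (m : ℚ) * 2 ^ 19 → ((phiK 13 5 - 2) / 2) * (Matroid.topCount M 12 5 : ℚ) ≤ (Matroid.midCount M 12 5 : ℚ) := by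
    intro U S m A hU hA hS hm hpoly htail
    exact c025_core_five_cell_of_counts_xqictq5g M 12 7 (by norm_num) hR hn U hU A hA S hS
      10219 (by norm_num) ((phiK 13 5 - 2) / 2) (by rw [phiK_thirteen_five]; norm_num) ⟨m, hm, hpoly, htail⟩
  -- the products, linearised by the caps
  have hmul : ∀ (a b c : ℕ), b ≤ c → a * b ≤ a * c := fun a b c h => Nat.mul_le_mul_left a h
  rcases (show r = 4 ∨ r = 5 by omega) with hr4e | hr5e
  · -- `w = 8`
    subst hr4e
    have hw : W.ncard = 8 := hWr
    rw [hw] at htop5 hsplit hsplit4 hsplit5 hsub6 hsub5d htop7 hS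
    norm_num [Finset.sum_Icc_succ_top, Nat.choose] at htop5 hS hsplit hsplit4 hsplit5 hsub6 hsub5d hD3W htop6 htop7 hT3N hD3N hsubT3 hT3four
    have h3 := hsplit 3
    have h4 := hsplit 4
    have h5' := hsplit 5
    have h6 := hsplit 6
    norm_num [Nat.choose] at h3 h4 h5' h6
    have hS' : {X : Set α | X ⊆ M.E ∧ M.eRk X = M.eRank}.ncard ≤ 41912 := by
      refine hS.trans ?_
      decide
    have hU' : Matroid.topCount M 12 5 ≤ 22954 := by
      have m1 := hmul {T : Set α | T ⊆ W ∧ T.ncard = 3 ∧ M.Indep T}.ncard _ _ hD3N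
      have m2 := hmul {T : Set α | T ⊆ W ∧ T.ncard = 4 ∧ M.Indep T}.ncard _ _ hD2N
      have m3 := hmul {T : Set α | T ⊆ W ∧ T.ncard = 4 ∧ M.Indep T}.ncard _ _ hT3four
      have m5 := hmul {T : Set α | T ⊆ W ∧ T.ncard = 4 ∧ M.eRk T = 3}.ncard _ _ hD3N
      have m6 := hmul {T : Set α | T ⊆ W ∧ T.ncard = 5 ∧ 4 ≤ M.eRk T}.ncard _ _ hD2N
      rw [hR42] at htop7
      omega
    exact cellA 22954 41912 200 (10870391 / 180) hU' hA' hS' (by norm_num) (by norm_num) (by norm_num)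
  · -- `w = 9`
    subst hr5e
    have hw : W.ncard = 9 := hWr
    have hWr5 : M.eRk W = 5 := by rw [← hr]; rfl
    have hR53 := S2.ncard_five_eRk_le_three_le M hfree hs hC1 hW hw hWr5
    rw [hw] at htop5 hsplit hsplit4 hsplit5 hsub6 hsub5d htop7 hS
    norm_num [Finset.sum_Icc_succ_top, Nat.choose] at htop5 hS hsplit hsplit4 hsplit5 hsub6 hsub5d hD3W htop6 htop7 hT3N hD3N hsubT3 hT3four
    have h3 := hsplit 3
    have h4 := hsplit 4
    have h5' := hsplit 5
    have h6 := hsplit 6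
    norm_num [Nat.choose] at h3 h4 h5' h6
    have hS' : {X : Set α | X ⊆ M.E ∧ M.eRk X = M.eRank}.ncard ≤ 53072 := by
      refine hS.trans ?_
      decide
    have hU' : Matroid.topCount M 12 5 ≤ 27615 := by
      have m1 := hmul {T : Set α | T ⊆ W ∧ T.ncard = 3 ∧ M.Indep T}.ncard _ _ hD3N
      have m2 := hmul {T : Set α | T ⊆ W ∧ T.ncard = 4 ∧ M.Indep T}.ncard _ _ hD2N
      have m3 := hmul {T : Set α | T ⊆ W ∧ T.ncard = 4 ∧ M.Indep T}.ncard _ _ hT3four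
      have m5 := hmul {T : Set α | T ⊆ W ∧ T.ncard = 4 ∧ M.eRk T = 3}.ncard _ _ hD3N
      have m6 := hmul {T : Set α | T ⊆ W ∧ T.ncard = 5 ∧ 4 ≤ M.eRk T}.ncard _ _ hD2N
      rw [hR42] at htop7
      omega
    exact cellA 27615 53072 222 (10870391 / 180) hU' hA' hS' (by norm_num) (by norm_num) (by norm_num)


/-- **The scaled coloop-free cell `(12, 7)` of `(13, 7)` at `K₁ = 10219`, unconditional.** -/
theorem c025_twelve_seven_cfk1 (M : Matroid α) [M.Finite]
    (hR : M.eRank = ((12 : ℕ) : ℕ∞)) (hn : M.E.ncard = 12 + 7)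
    (hfree : ∀ e ∈ M.E, ∃ A ⊆ M.E \ {e}, e ∉ M.closure A ∧ e ∉ M.closure ((M.E \ {e}) \ A)) (hK : ∀ e, ¬ M.IsColoop e) :
    ((phiK 13 5 - 2) / 2) * (Matroid.topCount M 12 5 : ℚ) ≤ (Matroid.midCount M 12 5 : ℚ) :=
  c025_twelve_seven_cfk1_of_nu_four
    (fun M' _ hR' hn' hfree' hK' _ h5' h4' => c025_twelve_seven_cfk1_nu_four M' hR' hn' hfree' hK' h5' h4') M hR hn hfree hK

end ThmN

end PercRepro
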